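import Mathlib
import Summits.ValiantsHypothesis.ValiantsHypothesis.Theorems.BarrierLeverPartitionMinorsHitByVPHiddenStatesFlagDesign

/-!
# Route BarrierLever — item `PartitionMinorsHitByVP` (stmt-ValiantsHypothesis-19717), line `hidden-states`:
# THE FLAG CELLS — the LOWER node at the top `≈ 4·log₂ h` sizes of EVERY `h` (cube flag ⊔ stars), and the full-cube cell for all `u`

Helper file (`--supports stmt-ValiantsHypothesis-19717`; cell valiant-natproofs, rung V4, 𝒟-side door (c), registered line
`Cruxes/PartitionMinorsHitByVP/Lines/hidden_states.lean` v7; prover seat val-np-p6 gen 11). Definition-free; closes NO item.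

THE POINT (the top bookend of the star range, for DOWN-SETS). A down-set `U ⊆ 2^{[h]}` of co-size `c` misses an up-set `𝒜` of `c` sets, and the
coordinates lying in every missing set (the CORE) number at least `h + 1 − c` (an up-set of size `c` contains the top and a co-singleton for each
non-core coordinate). Along `t ≤ h + 1 − c` core coordinates `x₀, …, x_{t−1}` the family `U` contains the whole CUBE FLAG
`{S : x₀,…,x_{p−1} ∈ S, x_p ∉ S}` (`p < t`; `2^h − 2^{h−t}` sets), which the `t` nested cube pieces of the design `𝔉(h,t,n)` (`…FlagDesign`) TILE
(shifted copies `{x_{<p}} ∪ σ_p(J)`); the remaining `2^{h−t} − c` sets all contain `x₀,…,x_{t−1}`, so none lies inside a flag set, and they are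
absorbed by the `2^{h−t} − c ≤ (2h − t)(h³ + 1)` star points (`SymbJoin.symGood_core_free`, p602295: tiled core + affinely free columns, any order).

* `card_noncore_succ_le` — the core bound.
* **`universalJoinWideLower_flag`** — for `t + 1 ≤ h`, `c + t ≤ h + 1`, `2^{h−t} ≤ (2h − t)(h³+1) + c`: the body of
  `LowerNode.Stmt.universalJoinWideLower` (p599518) at `(h, 2^h − c)` — ONE legal wide design for all lower `u` of that size.
* `universalJoinWideLower_cotop` — the same in the variables `d = h − t`: every `c ≤ d + 1` with `2^d ≤ (h + d)(h³ + 1)`, `1 ≤ d ≤ h − 1`;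
  so the lower node holds at the top `⌊log₂((h+d)(h³+1))⌋ + 2 ≈ 4 log₂ h + 2` sizes of every `h` (the co-star cells of parts 3/3b gave the top 5).
* `universalJoinWideLower_nineteen_cotop` — `h = 19`: every `r ≥ 2^19 − 18 = 524 270` (`d = 17`: `2^17 ≤ 36 · 6860`). The open LOWER window
  at `h = 19` (hub joins below, p611381: `r ≤ 517 158`) becomes `517 159 ≤ r ≤ 524 269`.
* `universalJoinWide_full` — the ALL-`u` node body at `r = 2^h` for every `h ≥ 2` (an injective family of all `2^h` sets is the whole cube,
  a lower set) — the «full-cube cell» the card listed as missing.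

WHAT THIS IS NOT: a logarithmic top window per `h`, nothing in the bulk `(2h⁴, 2^h − 4 log h)`; for non-lower `u` only the full cube; no stub of
the line is closed; nothing on crux 14610 or VP ≠ VNP.
-/

set_option linter.dupNamespace false

namespace Summit.ValiantsHypothesis.ValiantsHypothesis.Theorems.BarrierLever.HiddenStates

open Finset Matrix MvPolynomial

noncomputable section

namespace FlagCells

/-! ## 1. The core bound -/

/-- **Core bound.** A nonempty up-closed family `𝒜` of subsets of `Fin h` has at most `|𝒜| − 1` non-core coordinates (coordinates avoided by
some member): `#{x : ∃ A ∈ 𝒜, x ∉ A} + 1 ≤ |𝒜|`. -/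
theorem card_noncore_succ_le {h : ℕ} (𝒜 : Finset (Finset (Fin h))) (hup : ∀ A ∈ 𝒜, ∀ A', A ⊆ A' → A' ∈ 𝒜) (hne : 𝒜.Nonempty) :
    (Finset.univ.filter fun x : Fin h => ∃ A ∈ 𝒜, x ∉ A).card + 1 ≤ 𝒜.card := by
  classical
  set B := Finset.univ.filter fun x : Fin h => ∃ A ∈ 𝒜, x ∉ A with hB
  have huniv : (Finset.univ : Finset (Fin h)) ∈ 𝒜 := by
    obtain ⟨A, hA⟩ := hne; exact hup A hA _ (Finset.subset_univ A)
  have herase : ∀ x ∈ B, Finset.univ.erase x ∈ 𝒜 := by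
    intro x hx
    obtain ⟨A, hA, hxA⟩ := (Finset.mem_filter.mp hx).2
    exact hup A hA _ fun y hy => Finset.mem_erase.mpr ⟨fun hyx => hxA (hyx ▸ hy), Finset.mem_univ y⟩
  have hnot : (Finset.univ : Finset (Fin h)) ∉ B.image fun x => Finset.univ.erase x := by
    intro hmem
    obtain ⟨x, -, hx⟩ := Finset.mem_image.mp hmem
    have : x ∉ (Finset.univ : Finset (Fin h)).erase x := Finset.notMem_erase x _
    rw [hx] at this; exact this (Finset.mem_univ x)
  calc B.card + 1 = (insert Finset.univ (B.image fun x => Finset.univ.erase x)).card := by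
        rw [Finset.card_insert_of_notMem hnot, Finset.card_image_of_injOn fun x _ y _ hxy =>
          Finset.erase_injOn _ (Finset.mem_univ x) (Finset.mem_univ y) hxy]
    _ ≤ 𝒜.card := by
        apply Finset.card_le_card
        intro A hA
        rw [Finset.mem_insert] at hA
        rcases hA with rfl | hA
        · exact huniv
        · obtain ⟨x, hx, rfl⟩ := Finset.mem_image.mp hA; exact herase x hx

/-! ## 2. The flag cells -/

/-- **THE FLAG CELLS.** For `t + 1 ≤ h`, `c + t ≤ h + 1` and `2^{h−t} ≤ (2h − t)(h³ + 1) + c`, the body of `LowerNode.Stmt.universalJoinWideLower`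
holds at `(h, 2^h − c)`: the cube-flag design `𝔉(h, t, n)` serves EVERY injective lower row family of size `2^h − c`. -/
theorem universalJoinWideLower_flag (h t c : ℕ) (hth : t + 1 ≤ h) (hct : c + t ≤ h + 1)
    (hcap : 2 ^ (h - t) ≤ (h + h - t) * (h * h * h + 1) + c) :
    ∃ (m K : ℕ) (W : Fin m → ℕ) (wt : Fin m → Fin K → ℕ) (e : Fin (2 ^ h - c) → Fin m × Finset (Fin K)),
      m ≤ h + h ∧ K ≤ h * h * h ∧ Function.Injective e ∧
      (∀ x : Fin m × Finset (Fin K), x ∉ Set.range e →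
        ∀ i, W (e i).1 + ∑ k ∈ (e i).2, wt (e i).1 k < W x.1 + ∑ k ∈ x.2, wt x.1 k) ∧
      ∀ u : Fin (2 ^ h - c) → Finset (Fin h), Function.Injective u → IsLowerSet (Set.range u) →
        ∃ tx : Fin m → Option (Fin K) → Fin h → ℂ,
          (Matrix.of fun i k : Fin (2 ^ h - c) =>
            ∏ a ∈ u i, (tx (e k).1 none a + ∑ q ∈ (e k).2, tx (e k).1 (some q) a)).det ≠ 0 := by
  classical
  -- sizes
  have hpow_t : 2 ^ (h - t) ≤ 2 ^ h := Nat.pow_le_pow_right (by norm_num) (by omega)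
  have hc2 : c ≤ 2 ^ (h - t) := by
    have : h - t < 2 ^ (h - t) := Nat.lt_two_pow_self
    omega
  set N := 2 ^ (h - t) - c with hN
  obtain ⟨n, hn0, hnL, hsum⟩ := exists_distribution t (h * h * h + 1) (h + h) N (by rw [hN]; omega)
  have hr : 2 ^ h - c = (2 ^ h - 2 ^ (h - t)) + ∑ p, n p := by rw [hsum, hN]; omega
  obtain ⟨e, he, hthr, hmem⟩ := flag_design h t (by omega) n hn0 hnL (2 ^ h - c) hr
  refine ⟨h + h, h * h * h, fun p => if ((p : ℕ) < t ∨ 1 ≤ n p) then 0 else 2,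
    fun p q => if (p : ℕ) < t then (if (q : ℕ) < h - 1 - p then 0 else 2) else (if (q : ℕ) + 1 < n p then 1 else 2),
    e, le_rfl, le_rfl, he, hthr, ?_⟩
  intro u hu hlow
  -- the missing up-set
  set 𝒜 : Finset (Finset (Fin h)) := Finset.univ \ Finset.univ.image u with h𝒜
  have h𝒜c : 𝒜.card = c := by
    rw [h𝒜, Finset.card_sdiff_of_subset (Finset.subset_univ _), Finset.card_univ, Fintype.card_finset, Fintype.card_fin,
      Finset.card_image_of_injective _ hu, Finset.card_univ, Fintype.card_fin]
    omega
  have hrowiff : ∀ S, (∃ i, u i = S) ↔ S ∉ 𝒜 := by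
    intro S
    rw [h𝒜, Finset.mem_sdiff, not_and, not_not, Finset.mem_image]
    constructor
    · rintro ⟨i, rfl⟩ _; exact ⟨i, Finset.mem_univ _, rfl⟩
    · intro hS; obtain ⟨i, -, hi⟩ := hS (Finset.mem_univ _); exact ⟨i, hi⟩
  have hup : ∀ A ∈ 𝒜, ∀ A', A ⊆ A' → A' ∈ 𝒜 := by
    intro A hA A' hAA'
    rw [h𝒜, Finset.mem_sdiff] at hA ⊢
    refine ⟨Finset.mem_univ _, fun hA' => hA.2 ?_⟩
    obtain ⟨i, -, rfl⟩ := Finset.mem_image.mp hA'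
    obtain ⟨j, hj⟩ := hlow hAA' ⟨i, rfl⟩
    exact Finset.mem_image.mpr ⟨j, Finset.mem_univ _, hj⟩
  -- the core and `t` core coordinates
  set C₀ : Finset (Fin h) := Finset.univ.filter fun x => ∀ A ∈ 𝒜, x ∈ A with hC₀
  have hC₀t : t ≤ C₀.card := by
    by_cases hc0 : 𝒜 = ∅
    · have : C₀ = Finset.univ := by
        rw [hC₀]; ext x; simp [hc0]
      rw [this, Finset.card_univ, Fintype.card_fin]; omega
    · have hB := card_noncore_succ_le 𝒜 hup (Finset.nonempty_iff_ne_empty.mpr hc0)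
      have hcomp : (Finset.univ.filter fun x : Fin h => ∃ A ∈ 𝒜, x ∉ A) = Finset.univ \ C₀ := by
        rw [hC₀]; ext x; simp
      rw [hcomp, Finset.card_sdiff_of_subset (Finset.subset_univ _), Finset.card_univ, Fintype.card_fin, h𝒜c] at hB
      have : C₀.card ≤ h := by have := Finset.card_le_univ C₀; rwa [Fintype.card_fin] at this
      omega
  obtain ⟨D, hDC, hDcard⟩ := Finset.exists_subset_card_eq hC₀t
  let x : Fin t → Fin h := fun j => D.orderEmbOfFin hDcard j
  have hxinj : Function.Injective x := fun j j' hjj => (D.orderEmbOfFin hDcard).injective hjj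
  have hxcore : ∀ j, ∀ A ∈ 𝒜, x j ∈ A := fun j A hA =>
    (Finset.mem_filter.mp (hDC (Finset.orderEmbOfFin_mem D hDcard j))).2 A hA
  -- prefixes `X p = {x_j : j < p}`
  let X : ℕ → Finset (Fin h) := fun p => (Finset.univ.filter fun j : Fin t => (j : ℕ) < p).image x
  have hXmem : ∀ p a, a ∈ X p ↔ ∃ j : Fin t, (j : ℕ) < p ∧ x j = a := by
    intro p a; simp only [X, Finset.mem_image, Finset.mem_filter, Finset.mem_univ, true_and]
  have hXcard : ∀ p, p ≤ t → (X p).card = p := by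
    intro p hp
    simp only [X]
    rw [Finset.card_image_of_injective _ hxinj, Fin.card_filter_val_lt, min_eq_right hp]
  have hXmono : ∀ p, X p ⊆ X (p + 1) := by
    intro p a ha
    obtain ⟨j, hj, rfl⟩ := (hXmem p _).mp ha
    exact (hXmem (p + 1) _).mpr ⟨j, by omega, rfl⟩
  have hxX : ∀ (p : ℕ) (j : Fin t), x j ∈ X p ↔ (j : ℕ) < p := by
    intro p j
    rw [hXmem]
    constructor
    · rintro ⟨j', hj', hjj⟩; rw [← hxinj hjj]; exact hj'
    · intro hj; exact ⟨j, hj, rfl⟩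
  -- cube states and the bijections `σ_p : S_p → univ \ X (p+1)`
  let Sp : Fin (h + h) → Finset (Fin (h * h * h)) := fun p => Finset.univ.filter fun q => (q : ℕ) < h - 1 - p
  have hSp_card : ∀ p : Fin (h + h), (p : ℕ) < t → (Sp p).card = h - 1 - p := by
    intro p hp
    simp only [Sp]
    rw [Fin.card_filter_val_lt, min_eq_right]
    have : h ≤ h * h * h := le_trans (Nat.le_mul_of_pos_right h (by omega)) (Nat.le_mul_of_pos_right _ (by omega))
    omega
  have hσex : ∀ p : Fin (h + h), ∃ σp : Fin (h * h * h) → Fin h,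
      ((p : ℕ) < t → Set.InjOn σp ↑(Sp p) ∧ (Sp p).image σp = Finset.univ \ X (p + 1)) := by
    intro p
    by_cases hp : (p : ℕ) < t
    · have hcard : (Finset.univ \ X (p + 1)).card = (Sp p).card := by
        rw [Finset.card_sdiff_of_subset (Finset.subset_univ _), Finset.card_univ, Fintype.card_fin, hXcard _ (by omega),
          hSp_card p hp]; omega
      have hne : (Finset.univ \ X (p + 1)).Nonempty := by
        rw [← Finset.card_pos, hcard, hSp_card p hp]; omega
      obtain ⟨σp, h1, h2⟩ := SymbJoin.exists_injOn_image_eq (Sp p) (Finset.univ \ X (p + 1)) hcard hne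
      exact ⟨σp, fun _ => ⟨h1, h2⟩⟩
    · exact ⟨fun _ => ⟨0, by omega⟩, fun h' => absurd h' hp⟩
  choose σ hσ using hσex
  let Cst : Fin (h + h) → Finset (Fin h) := fun p => X p
  -- the tiles of the cube columns
  let T : Fin (2 ^ h - c) → Finset (Fin h) := fun k => Cst (e k).1 ∪ ((e k).2).image (σ (e k).1)
  have hcube : ∀ k, ((e k).1 : ℕ) < t → (e k).2 ⊆ Sp (e k).1 := by
    intro k hk q hq
    rcases (hmem (e k)).mp ⟨k, rfl⟩ with ⟨-, hJ⟩ | ⟨hge, -⟩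
    · exact Finset.mem_filter.mpr ⟨Finset.mem_univ _, hJ q hq⟩
    · omega
  have hTsub : ∀ k, ((e k).1 : ℕ) < t → ((e k).2).image (σ (e k).1) ⊆ Finset.univ \ X ((e k).1 + 1) := by
    intro k hk
    rw [← (hσ (e k).1 hk).2]
    exact Finset.image_subset_image (hcube k hk)
  have hxT : ∀ k (hk : ((e k).1 : ℕ) < t), x ⟨(e k).1, hk⟩ ∉ T k := by
    intro k hk hmemT
    rcases Finset.mem_union.mp hmemT with h1 | h1
    · exact absurd ((hxX _ _).mp h1) (lt_irrefl _)
    · have := hTsub k hk h1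
      rw [Finset.mem_sdiff] at this
      exact this.2 ((hxX _ _).mpr (Nat.lt_succ_self _))
  have hTrow : ∀ k, ((e k).1 : ℕ) < t → ∃ i, u i = T k := by
    intro k hk
    apply (hrowiff _).mpr
    intro hT𝒜
    exact hxT k hk (hxcore ⟨(e k).1, hk⟩ _ hT𝒜)
  -- tiles of distinct cube columns are distinct
  have hTinj : ∀ k k', ((e k).1 : ℕ) < t → ((e k').1 : ℕ) < t → T k = T k' → k = k' := by
    intro k k' hk hk' hTT
    have hp : (e k).1 = (e k').1 := by
      by_contra hne
      rcases lt_or_gt_of_ne (fun heq => hne (Fin.ext heq)) with hlt | hlt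
      · apply hxT k hk
        rw [hTT]
        exact Finset.mem_union_left _ ((hxX _ _).mpr hlt)
      · apply hxT k' hk'
        rw [← hTT]
        exact Finset.mem_union_left _ ((hxX _ _).mpr hlt)
    apply he
    refine Prod.ext hp ?_
    have hdisj : ∀ k₁, ((e k₁).1 : ℕ) < t → Disjoint (X (e k₁).1) (((e k₁).2).image (σ (e k₁).1)) := by
      intro k₁ hk₁
      rw [Finset.disjoint_left]
      intro a ha ha'
      have := hTsub k₁ hk₁ ha'
      rw [Finset.mem_sdiff] at this
      exact this.2 (hXmono _ ha)
    have himg : ((e k).2).image (σ (e k).1) = ((e k').2).image (σ (e k).1) := by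
      have h1 := hdisj k hk
      have h2 := hdisj k' hk'
      change X (e k).1 ∪ ((e k).2).image (σ (e k).1) = X (e k').1 ∪ ((e k').2).image (σ (e k').1) at hTT
      rw [← hp] at hTT h2
      ext a
      constructor
      · intro ha
        have : a ∈ X (e k).1 ∪ ((e k').2).image (σ (e k).1) := hTT ▸ Finset.mem_union_right _ ha
        rcases Finset.mem_union.mp this with h3 | h3
        · exact absurd ha (Finset.disjoint_left.mp h1 h3)
        · exact h3
      · intro ha
        have : a ∈ X (e k).1 ∪ ((e k).2).image (σ (e k).1) := hTT.symm ▸ Finset.mem_union_right _ ha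
        rcases Finset.mem_union.mp this with h3 | h3
        · exact absurd ha (Finset.disjoint_left.mp h2 h3)
        · exact h3
    have hk'sub : (e k').2 ⊆ Sp (e k).1 := by rw [hp]; exact hcube k' hk'
    exact SymbJoin.image_injOn_subsets (hσ (e k).1 hk).1 (hcube k hk) hk'sub himg
  -- the core columns and rows
  set Cc : Finset (Fin (2 ^ h - c)) := Finset.univ.filter fun k => ((e k).1 : ℕ) < t with hCc
  let col : Fin Cc.card → Fin (2 ^ h - c) := fun j => (Cc.equivFin.symm j).1
  have hcol_lt : ∀ j, ((e (col j)).1 : ℕ) < t := fun j => (Finset.mem_filter.mp (Cc.equivFin.symm j).2).2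
  have hcol_inj : Function.Injective col := fun j j' hjj => Cc.equivFin.symm.injective (Subtype.ext hjj)
  choose rowf hrowf using hTrow
  let row : Fin Cc.card → Fin (2 ^ h - c) := fun j => rowf (col j) (hcol_lt j)
  have hrow_spec : ∀ j, u (row j) = T (col j) := fun j => hrowf (col j) (hcol_lt j)
  have hrow_inj : Function.Injective row := by
    intro j j' hjj
    apply hcol_inj
    apply hTinj _ _ (hcol_lt j) (hcol_lt j')
    rw [← hrow_spec, ← hrow_spec, hjj]
  refine SymbJoin.exists_table_of_core_free u hu e row col hrow_inj hcol_inj Cst σ ?_ ?_ ?_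
  · -- tiling
    intro j a
    rw [hrow_spec]
    simp only [T, Cst, Finset.mem_union, Finset.mem_image]
  · -- non-core rows lie inside no tile: otherwise they ARE tiles
    intro i hi j hsub
    apply hi
    rw [hrow_spec] at hsub
    have hk := hcol_lt j
    -- the least flag index missing from `u i`
    set Fm : Finset (Fin t) := Finset.univ.filter fun jj : Fin t => x jj ∉ u i with hFm
    have hmiss : Fm.Nonempty :=
      ⟨⟨(e (col j)).1, hk⟩, Finset.mem_filter.mpr ⟨Finset.mem_univ _, fun hmem => hxT (col j) hk (hsub hmem)⟩⟩
    set j₀ : Fin t := Fm.min' hmiss with hj₀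
    have hj₀miss : x j₀ ∉ u i := (Finset.mem_filter.mp (Finset.min'_mem Fm hmiss)).2
    have hbelow : ∀ jj : Fin t, (jj : ℕ) < j₀ → x jj ∈ u i := by
      intro jj hjj
      by_contra hno
      have hjjF : jj ∈ Fm := Finset.mem_filter.mpr ⟨Finset.mem_univ jj, hno⟩
      have := Finset.min'_le Fm jj hjjF
      rw [← hj₀] at this
      exact absurd hjj (not_lt.mpr this)
    -- the piece `p₀ = j₀` and the state set `J₀`
    let p₀ : Fin (h + h) := ⟨j₀, by omega⟩
    have hp₀ : (p₀ : ℕ) < t := j₀.2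
    let J₀ : Finset (Fin (h * h * h)) := (Sp p₀).filter fun q => σ p₀ q ∈ u i
    obtain ⟨k₀, hk₀⟩ : ((p₀, J₀) : Fin (h + h) × Finset (Fin (h * h * h))) ∈ Set.range e :=
      (hmem _).mpr (Or.inl ⟨hp₀, fun q hq => (Finset.mem_filter.mp (Finset.mem_filter.mp hq).1).2⟩)
    have hTk₀ : T k₀ = u i := by
      simp only [T, hk₀, Cst]
      ext a
      simp only [Finset.mem_union, Finset.mem_image, J₀, Finset.mem_filter]
      constructor
      · rintro (ha | ⟨q, ⟨-, hq⟩, rfl⟩)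
        · obtain ⟨jj, hjj, rfl⟩ := (hXmem _ _).mp ha
          exact hbelow jj hjj
        · exact hq
      · intro ha
        by_cases haX : a ∈ X j₀
        · exact Or.inl haX
        · right
          have ha' : a ∈ Finset.univ \ X (j₀ + 1) := by
            rw [Finset.mem_sdiff]
            refine ⟨Finset.mem_univ _, fun hmem => ?_⟩
            obtain ⟨jj, hjj, rfl⟩ := (hXmem _ _).mp hmem
            rcases Nat.lt_succ_iff_lt_or_eq.mp hjj with hlt | heq
            · exact haX ((hxX _ _).mpr hlt)
            · exact hj₀miss (by rw [← Fin.ext heq]; exact ha)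
          rw [← (hσ p₀ hp₀).2] at ha'
          obtain ⟨q, hq, rfl⟩ := Finset.mem_image.mp ha'
          exact ⟨q, ⟨hq, ha⟩, rfl⟩
    have hk₀C : k₀ ∈ Cc := Finset.mem_filter.mpr ⟨Finset.mem_univ _, by rw [hk₀]; exact hp₀⟩
    refine ⟨Cc.equivFin ⟨k₀, hk₀C⟩, hu ?_⟩
    rw [hrow_spec]
    simp only [col, Equiv.symm_apply_apply]
    exact hTk₀
  · -- the star columns are affinely free inside their piece
    intro k hk
    have hge : ¬ ((e k).1 : ℕ) < t := fun hlt =>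
      hk ⟨Cc.equivFin ⟨k, Finset.mem_filter.mpr ⟨Finset.mem_univ _, hlt⟩⟩, by simp [col]⟩
    have hstar : ∀ k', (e k').1 = (e k).1 → (e k').2 = ∅ ∨ ∃ q, (e k').2 = {q} := by
      intro k' hk'
      rcases (hmem (e k')).mp ⟨k', rfl⟩ with ⟨hlt, -⟩ | ⟨-, ⟨h0, -⟩ | ⟨q, hq, -⟩⟩
      · exact absurd (hk' ▸ hlt) hge
      · exact Or.inl h0
      · exact Or.inr ⟨q, hq⟩
    have hphi0 : ∀ cc : Option (Fin (h * h * h)) → ℂ, SymbJoin.phi cc ∅ = cc none := fun cc => by simp [SymbJoin.phi]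
    have hphi1 : ∀ (cc : Option (Fin (h * h * h)) → ℂ) (q₁ : Fin (h * h * h)), SymbJoin.phi cc {q₁} = cc none + cc (some q₁) :=
      fun cc q₁ => by simp [SymbJoin.phi]
    rcases hstar k rfl with h0 | ⟨q, hq⟩
    · refine ⟨fun o => Option.elim o 1 fun _ => -1, by rw [h0, hphi0]; rfl, fun k' hk' hp => ?_⟩
      rcases hstar k' hp with h0' | ⟨q', hq'⟩
      · exact absurd (he (Prod.ext hp (h0'.trans h0.symm))) hk'
      · rw [hq', hphi1]; show (1 : ℂ) + -1 = 0; norm_num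
    · refine ⟨fun o => Option.elim o 0 fun q' => if q' = q then 1 else 0, ?_, fun k' hk' hp => ?_⟩
      · rw [hq, hphi1]; show (0 : ℂ) + (if q = q then 1 else 0) = 1; rw [if_pos rfl]; norm_num
      rcases hstar k' hp with h0' | ⟨q', hq'⟩
      · rw [h0', hphi0]; rfl
      · have hqq : q' ≠ q := fun hqq => hk' (he (Prod.ext hp (by rw [hq', hq, hqq])))
        rw [hq', hphi1]; show (0 : ℂ) + (if q' = q then 1 else 0) = 0; rw [if_neg hqq]; norm_num

/-! ## 3. Corollaries -/

/-- **The lower node at the top `d + 2` sizes of every `h`**, `1 ≤ d ≤ h − 1`, `2^d ≤ (h + d)(h³ + 1)`: for every `c ≤ d + 1` the body of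
`LowerNode.Stmt.universalJoinWideLower` holds at `(h, 2^h − c)`. -/
theorem universalJoinWideLower_cotop (h d c : ℕ) (hd1 : 1 ≤ d) (hdh : d + 1 ≤ h) (hpow : 2 ^ d ≤ (h + d) * (h * h * h + 1))
    (hc : c ≤ d + 1) :
    ∃ (m K : ℕ) (W : Fin m → ℕ) (wt : Fin m → Fin K → ℕ) (e : Fin (2 ^ h - c) → Fin m × Finset (Fin K)),
      m ≤ h + h ∧ K ≤ h * h * h ∧ Function.Injective e ∧
      (∀ x : Fin m × Finset (Fin K), x ∉ Set.range e →
        ∀ i, W (e i).1 + ∑ k ∈ (e i).2, wt (e i).1 k < W x.1 + ∑ k ∈ x.2, wt x.1 k) ∧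
      ∀ u : Fin (2 ^ h - c) → Finset (Fin h), Function.Injective u → IsLowerSet (Set.range u) →
        ∃ tx : Fin m → Option (Fin K) → Fin h → ℂ,
          (Matrix.of fun i k : Fin (2 ^ h - c) =>
            ∏ a ∈ u i, (tx (e k).1 none a + ∑ q ∈ (e k).2, tx (e k).1 (some q) a)).det ≠ 0 := by
  have ht : h - (h - d) = d := by omega
  have h2 : h + h - (h - d) = h + d := by omega
  exact universalJoinWideLower_flag h (h - d) c (by omega) (by omega) (by rw [ht, h2]; omega)

/-- **`h = 19`: the lower node for every `r ≥ 2^19 − 18 = 524 270`.** -/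
theorem universalJoinWideLower_nineteen_cotop (c : ℕ) (hc : c ≤ 18) :
    ∃ (m K : ℕ) (W : Fin m → ℕ) (wt : Fin m → Fin K → ℕ) (e : Fin (2 ^ 19 - c) → Fin m × Finset (Fin K)),
      m ≤ 19 + 19 ∧ K ≤ 19 * 19 * 19 ∧ Function.Injective e ∧
      (∀ x : Fin m × Finset (Fin K), x ∉ Set.range e →
        ∀ i, W (e i).1 + ∑ k ∈ (e i).2, wt (e i).1 k < W x.1 + ∑ k ∈ x.2, wt x.1 k) ∧
      ∀ u : Fin (2 ^ 19 - c) → Finset (Fin 19), Function.Injective u → IsLowerSet (Set.range u) →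
        ∃ tx : Fin m → Option (Fin K) → Fin 19 → ℂ,
          (Matrix.of fun i k : Fin (2 ^ 19 - c) =>
            ∏ a ∈ u i, (tx (e k).1 none a + ∑ q ∈ (e k).2, tx (e k).1 (some q) a)).det ≠ 0 :=
  universalJoinWideLower_cotop 19 17 c (by norm_num) (by norm_num) (by norm_num) (by omega)

/-- **The ALL-`u` node at the full cube `r = 2^h`, every `h ≥ 2`.** An injective family of `2^h` subsets of `Fin h` is all of them, hence lower. -/
theorem universalJoinWide_full (h : ℕ) (h2 : 2 ≤ h) :
    ∃ (m K : ℕ) (W : Fin m → ℕ) (wt : Fin m → Fin K → ℕ) (e : Fin (2 ^ h) → Fin m × Finset (Fin K)),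
      m ≤ h + h ∧ K ≤ h * h * h ∧ Function.Injective e ∧
      (∀ x : Fin m × Finset (Fin K), x ∉ Set.range e →
        ∀ i, W (e i).1 + ∑ k ∈ (e i).2, wt (e i).1 k < W x.1 + ∑ k ∈ x.2, wt x.1 k) ∧
      ∀ u : Fin (2 ^ h) → Finset (Fin h), Function.Injective u →
        ∃ tx : Fin m → Option (Fin K) → Fin h → ℂ,
          (Matrix.of fun i k : Fin (2 ^ h) =>
            ∏ a ∈ u i, (tx (e k).1 none a + ∑ q ∈ (e k).2, tx (e k).1 (some q) a)).det ≠ 0 := by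
  classical
  obtain ⟨m, K, W, wt, e, hm, hK, he, hthr, hgood⟩ :=
    universalJoinWideLower_cotop h 1 0 le_rfl (by omega) (by nlinarith) (by omega)
  refine ⟨m, K, W, wt, e, hm, hK, he, hthr, fun u hu => hgood u hu ?_⟩
  -- an injective family of `2^h` sets is surjective
  have hsurj : Function.Surjective u := by
    have hbij := (Fintype.bijective_iff_injective_and_card u).mpr ⟨hu, by simp [Fintype.card_finset]⟩
    exact hbij.2
  intro S S' _ _
  exact hsurj S'

end FlagCells

end

end Summit.ValiantsHypothesis.ValiantsHypothesis.Theorems.BarrierLever.HiddenStates
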